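import Summits.BirchSwinnertonDyer.BirchSwinnertonDyer.Theorems.ResidualThetaTransportAtTwoResidualThetaMainConjectureAtTwoPollackPairKConstruction
import HarnessLib

/-!
# Crux `ResidualThetaMainConjectureAtTwo` (stmt-BirchSwinnertonDyer-20787), line `birth` v6 — stub (R1e)
# `stub_normLambdaWitnessAtTwo`: every non-zero `L ∈ 𝓞⟦T⟧` has a NORM-λ WITNESS (`𝓞 = 𝓞_{ℚ₂(ι K_g)}` is a DVR)

Cell `bsd-wall`, seat `bsd-wall-rtt-p2` (LEAD PROVER, line mode, g2). THEOREMS ONLY (no `def`, no named fact, no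
`sorry`). Proves the registered stub (R1e) of skeleton v6 VERBATIM: for a newform `g`, an embedding `ι : K_g → ℚ̄₂` and
`0 ≠ L ∈ 𝓞⟦T⟧`, there is an index `d` at which the coefficient norm of `L` (read in `ℚ̄₂`) is maximal, and strictly
larger than all earlier coefficient norms — the "norm-language λ-invariant" used by stubs (R1a)/(R1b). Reason:
`𝓞 = unitBall ℚ₂(ι K_g)` (file `…PollackPairKConstruction`) is a discrete valuation ring (local PID, `2` a non-zero
non-unit; `K_g` is a number field, Shimura 3.48), so every non-zero coefficient has norm `‖ϖ‖ⁿ` for a uniformiser `ϖ`,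
`‖ϖ‖ < 1`, and a minimal exponent is attained first at some index. BSD is not proved by any of this.

Refs: [NeukirchANT1999] Ch. II (3.8)–(4.8); [Shimura1971] Thm. 3.48.
-/

set_option linter.dupNamespace false
set_option autoImplicit false

noncomputable section

open scoped Classical

open Polynomial Literature.NumberTheory.EllipticCurves Literature.NumberTheory.EllipticCurves.ModularForms
  Literature.NumberTheory.Automorphic

namespace Summit.BirchSwinnertonDyer.BirchSwinnertonDyer.Theorems.ResidualThetaLayer

/-- **Stub (R1e) `stub_normLambdaWitnessAtTwo` of crux `ResidualThetaMainConjectureAtTwo` (line `birth` v6), VERBATIM**: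
a non-zero element of `𝓞⟦T⟧` has a norm-λ witness (see the module docstring). [cite: NeukirchANT1999, Ch. II (4.8)] -/
theorem stub_normLambdaWitnessAtTwo : ∀ (M : ℕ) [NeZero M] (g : CuspForm (CongruenceSubgroup.Gamma0 M) 2) (ι : Literature.NumberTheory.EllipticCurves.ModularForms.coeffField g →+* PadicAlgCl 2), Literature.NumberTheory.EllipticCurves.ModularForms.IsNewform0 g → ∀ (Lm : Literature.NumberTheory.EllipticCurves.IwasawaAlgebraO (Set.range ι)), Lm ≠ 0 → ∃ d : ℕ, (∀ k : ℕ, ‖PowerSeries.coeff k (Literature.NumberTheory.EllipticCurves.iwasawaOToPowerSeries (Set.range ι) Lm)‖ ≤ ‖PowerSeries.coeff d (Literature.NumberTheory.EllipticCurves.iwasawaOToPowerSeries (Set.range ι) Lm)‖) ∧ (∀ k : ℕ, k < d → ‖PowerSeries.coeff k (Literature.NumberTheory.EllipticCurves.iwasawaOToPowerSeries (Set.range ι) Lm)‖ < ‖PowerSeries.coeff d (Literature.NumberTheory.EllipticCurves.iwasawaOToPowerSeries (Set.range ι) Lm)‖) := by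
  intro M _ g ι hnew Lm hLm
  -- `𝓞 = unitBall E`, `E = ℚ₂(ι K_g)` finite over `ℚ₂`; a DVR
  set E : IntermediateField ℚ_[2] (PadicAlgCl 2) := padicCoeffField (Set.range ι) with hE
  haveI : FiniteDimensional ℚ (coeffField g) := IsNewform0.finiteDimensional_coeffField_holds hnew
  haveI : FiniteDimensional ℚ_[2] E := GreenbergSelmer.finiteDimensional_padicCoeffField ι
  set U := PadicIntermediateField.unitBall 2 E with hU
  haveI : IsDiscreteValuationRing U :=
    { not_a_field' := fun h ↦ PadicIntermediateField.natCast_prime_ne_zero 2 E (by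
        have hm := PadicIntermediateField.natCast_prime_mem_maximalIdeal 2 E
        rw [h, Ideal.mem_bot] at hm
        exact hm) }
  obtain ⟨ϖ, hϖ⟩ := IsDiscreteValuationRing.exists_irreducible U
  -- norms of elements of `U`
  set c : ℝ := ‖(ϖ : PadicAlgCl 2)‖ with hc
  have hc1 : c < 1 := by
    have hle : Valued.v (ϖ : PadicAlgCl 2) ≤ 1 := PadicIntermediateField.valued_le_one_of_mem_unitBall 2 E ϖ.2
    have hne : Valued.v (ϖ : PadicAlgCl 2) ≠ 1 := fun h ↦
      hϖ.not_isUnit (PadicIntermediateField.isUnit_of_valued_eq_one 2 E h)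
    have hlt : Valued.v (ϖ : PadicAlgCl 2) < 1 := lt_of_le_of_ne hle hne
    rw [PadicAlgCl.valuation_def] at hlt
    exact_mod_cast hlt
  have hc0 : 0 < c := by
    rw [hc, norm_pos_iff]
    intro h
    exact hϖ.ne_zero (Subtype.ext h)
  have hnormU : ∀ x : U, x ≠ 0 → ∃ n : ℕ, ‖(x : PadicAlgCl 2)‖ = c ^ n := by
    intro x hx
    obtain ⟨n, u, hxu⟩ := IsDiscreteValuationRing.eq_unit_mul_pow_irreducible hx hϖ
    refine ⟨n, ?_⟩
    have hu : ‖((u : U) : PadicAlgCl 2)‖ = 1 := by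
      have := PadicIntermediateField.valued_eq_one_of_isUnit 2 E (Units.isUnit u)
      rw [PadicAlgCl.valuation_def] at this
      rw [← coe_nnnorm, this, NNReal.coe_one]
    rw [hxu, Subring.coe_mul, Subring.coe_pow, norm_mul, norm_pow, hu, one_mul]
  -- the coefficients of `L`, as elements of `U`
  have hOU : padicCoeffIntegers (Set.range ι) = U := padicCoeffIntegers_eq_unitBall (Set.range ι)
  set a : ℕ → PadicAlgCl 2 := fun k ↦ PowerSeries.coeff k (iwasawaOToPowerSeries (Set.range ι) Lm) with ha
  have hak : ∀ k, a k = ((PowerSeries.coeff k Lm : padicCoeffIntegers (Set.range ι)) : PadicAlgCl 2) := fun k ↦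
    coeff_iwasawaOToPowerSeries (Set.range ι) Lm k
  have hnorm : ∀ k, a k ≠ 0 → ∃ n : ℕ, ‖a k‖ = c ^ n := by
    intro k hk
    have hmem : a k ∈ U := by rw [← hOU, hak]; exact (PowerSeries.coeff k Lm).2
    obtain ⟨n, hn⟩ := hnormU ⟨a k, hmem⟩ (fun h ↦ hk (congrArg Subtype.val h))
    exact ⟨n, hn⟩
  -- some coefficient is non-zero
  have hex : ∃ k, a k ≠ 0 := by
    by_contra h
    push Not at h
    apply hLm
    apply iwasawaOToPowerSeries_injective (Set.range ι)
    rw [map_zero]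
    exact PowerSeries.ext fun k ↦ by rw [map_zero]; exact h k
  -- the minimal exponent `n₀`, and the first index `d` where it occurs
  have hP : ∃ n : ℕ, ∃ k, a k ≠ 0 ∧ ‖a k‖ = c ^ n := by
    obtain ⟨k, hk⟩ := hex
    obtain ⟨n, hn⟩ := hnorm k hk
    exact ⟨n, k, hk, hn⟩
  set n₀ := Nat.find hP with hn₀
  have hn₀spec : ∃ k, a k ≠ 0 ∧ ‖a k‖ = c ^ n₀ := Nat.find_spec hP
  have hn₀min : ∀ k, a k ≠ 0 → c ^ n₀ ≥ ‖a k‖ := by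
    intro k hk
    obtain ⟨n, hn⟩ := hnorm k hk
    have hle : n₀ ≤ n := Nat.find_min' hP ⟨k, hk, hn⟩
    rw [hn]
    exact pow_le_pow_of_le_one hc0.le hc1.le hle
  set d := Nat.find hn₀spec with hd
  obtain ⟨hd0, hdn⟩ : a d ≠ 0 ∧ ‖a d‖ = c ^ n₀ := Nat.find_spec hn₀spec
  refine ⟨d, fun k ↦ ?_, fun k hk ↦ ?_⟩
  · change ‖a k‖ ≤ ‖a d‖
    rw [hdn]
    by_cases hk : a k = 0
    · rw [hk, norm_zero]; exact pow_nonneg hc0.le _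
    · exact hn₀min k hk
  · change ‖a k‖ < ‖a d‖
    rw [hdn]
    by_cases hk0 : a k = 0
    · rw [hk0, norm_zero]; exact pow_pos hc0 _
    · obtain ⟨n, hn⟩ := hnorm k hk0
      have hle : n₀ ≤ n := Nat.find_min' hP ⟨k, hk0, hn⟩
      have hne : n ≠ n₀ := by
        intro h
        exact Nat.find_min hn₀spec hk ⟨hk0, by rw [hn, h]⟩
      rw [hn]
      exact pow_lt_pow_right_of_lt_one₀ hc0 hc1 (lt_of_le_of_ne hle (Ne.symm hne))

end Summit.BirchSwinnertonDyer.BirchSwinnertonDyer.Theorems.ResidualThetaLayer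

end
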